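import Mathlib
import HarnessLib
import Summits.NavierStokesRegularity.NavierStokesRegularity.Theses.RellichScar
import Literature.Barriers.NavierStokesRegularity.AxisymmetricTypeIExclusionHolds
import Literature.Analysis.FluidPDE.SlabPressureNormalization
import Literature.Analysis.FluidPDE.SuitableWeakCongr
import Literature.Analysis.FluidPDE.WeakSolutionProofs
import Literature.Analysis.FluidPDE.Seregin2020AncientLimitSymmetry

/-!
# Route RellichScar, item `AxisymmetricApexFatal`: an apex profile singular at the origin is not
# a.e. axisymmetric

Closes the support item stmt-NavierStokesRegularity-11722 of route `RellichScar`
(`Summit.NavierStokesRegularity.NavierStokesRegularity.Theses.RellichScar.AxisymmetricApexFatal`):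
a suitable weak solution `(u, p)` of Navier–Stokes (`ν = 1`, `f = 0`) on the backward slab
`(-∞, 0) × ℝ³` with a weak gradient, Albritton–Barker quantity `𝐈(ℝ³ × ℝ₋) < ∞`, the space–time
Type I bound `‖u(t, x)‖ ≤ C/(‖x‖ + √(−t))`, singular at the space–time origin, cannot be
axisymmetric almost everywhere (`R_θ u(t, R_θ⁻¹ x) = u(t, x)` for a.e. `(t, x)`, for every `θ`).

Proof (known mathematics; bookkeeping around Seregin–Šverák 2009, Thm 3.1 = Thm 1.1, which is the
PROVED barrier `Literature.Barriers.NavierStokesRegularity.AxisymmetricTypeIExclusion_holds`):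

1. **Haar averaging** (`exists_axisymmetric_ae_eq`): averaging `θ ↦ R_θ u(t, R_θ⁻¹ x)` over a full
   turn gives a field `v` every slice of which is EXACTLY axisymmetric, and `v = u` a.e. on the slab
   (Tonelli on `(t, x; θ)`: for a.e. `(t, x)` the integrand equals `u(t, x)` for a.e. `θ`).
2. **Pressure normalisation** (tree: `SlabPressureNormalization.lean`, Albritton–Barker 2019 §3):
   `q = p − [p]_{B(0,1)}(t)` keeps `(u, q)` suitable on the slab with the same `𝐈`, and makes
   `q ∈ L^{3/2}(Q(0, 2))`, `u ∈ L³(Q(0, 2))` (`isSuitableWeakSolutionInBall_of_slab`).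
3. The Seregin–Šverák unit cylinder `𝒞 × ]-1, 0[` lies in `Q(0, 2)`; restricting (`of_le`) and
   changing the representative (`congr_ae`) makes `(v, q)` a distributional solution there with
   `v ∈ L³`, `q ∈ L^{3/2}`, axisymmetric slices and `√(−t)‖v‖ ≤ |C|` a.e.; the barrier gives
   `v ∈ L^∞(Q(0, r))` for some `r > 0`, hence `u ∈ L^∞(Q(0, r))`, contradicting the singularity
   of the origin (`IsBackwardSingularPoint u 0`).

## References

* G. Seregin, V. Šverák, *On Type I singularities of the local axi-symmetric solutions of the
  Navier–Stokes equations*, Comm. PDE 34 (2009), 171–201, Thm 3.1 (= Thm 1.1). [SereginSverak2009]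
* G. Koch, N. Nadirashvili, G. Seregin, V. Šverák, Acta Math. 203 (2009), 83–105, §1. [KNSS2009]
* D. Albritton, T. Barker, J. Math. Fluid Mech. 21 (2019), §3 (normalised pressures). [AlbrittonBarker2019]
-/

-- the summit and its single sub-problem share the name (CONVENTIONS §1), as in every Theorems file
set_option linter.dupNamespace false

noncomputable section

namespace Summit.NavierStokesRegularity.NavierStokesRegularity.Theorems

open MeasureTheory Set Function Filter TopologicalSpace Metric
open scoped ENNReal NNReal
open Literature.Analysis.FluidPDE Literature.Barriers.NavierStokesRegularity

local notation "ℝ³" => EuclideanSpace ℝ (Fin 3)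

/-! ### Haar averaging: an exactly axisymmetric representative of an a.e. axisymmetric field -/

/-- `(θ, x) ↦ R_θ x` is jointly continuous (re-proved here with a light import closure; cf.
`Literature.Analysis.FluidPDE.continuous_rotZ_prod`). [folklore] -/
theorem continuous_rotZ_uncurry : Continuous fun q : ℝ × ℝ³ => rotZ q.1 q.2 := by
  unfold rotZ
  refine (PiLp.continuous_toLp 2 _).comp ?_
  refine continuous_pi fun i => ?_
  have h0 : Continuous fun q : ℝ × ℝ³ => q.2 0 := (PiLp.continuous_apply 2 _ 0).comp continuous_snd
  have h1 : Continuous fun q : ℝ × ℝ³ => q.2 1 := (PiLp.continuous_apply 2 _ 1).comp continuous_snd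
  have h2 : Continuous fun q : ℝ × ℝ³ => q.2 2 := (PiLp.continuous_apply 2 _ 2).comp continuous_snd
  have hc : Continuous fun q : ℝ × ℝ³ => Real.cos q.1 := Real.continuous_cos.comp continuous_fst
  have hs : Continuous fun q : ℝ × ℝ³ => Real.sin q.1 := Real.continuous_sin.comp continuous_fst
  fin_cases i
  · exact ((hc.mul h0).sub (hs.mul h1)).congr fun q => by simp
  · exact ((hs.mul h0).add (hc.mul h1)).congr fun q => by simp
  · exact h2.congr fun q => by simp

/-- A full turn does not change the rotation: `R_{θ + 2π} = R_θ`. [folklore] -/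
theorem rotZ_add_two_pi_eq (θ : ℝ) (x : ℝ³) : rotZ (θ + 2 * Real.pi) x = rotZ θ x := by
  ext i
  fin_cases i <;> simp [Real.cos_add_two_pi, Real.sin_add_two_pi]

/-- **Product measurability of the conjugated field.** For `f` a.e.-strongly measurable on the
cylinder `I × ℝ³` and any s-finite measure `ν` on the angles, the field
`((t, x), φ) ↦ R_φ f(t, R_{-φ} x)` is a.e.-strongly measurable for the product measure: the
space–time rotations `(t, x) ↦ (t, R_{-φ} x)` preserve Lebesgue measure restricted to the
cylinder, so `((t, x), φ) ↦ (t, R_{-φ} x)` is quasi-measure-preserving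
(`QuasiMeasurePreserving.prod_of_left`), and `(φ, y) ↦ R_φ y` is continuous. [folklore] -/
theorem aestronglyMeasurable_rotZ_conj {I : Set ℝ} (hI : MeasurableSet I) {f : ℝ × ℝ³ → ℝ³}
    (hf : AEStronglyMeasurable f (volume.restrict (I ×ˢ (univ : Set ℝ³)))) (ν : Measure ℝ)
    [SFinite ν] :
    AEStronglyMeasurable (fun q : (ℝ × ℝ³) × ℝ => rotZ q.2 (f ((q.1).1, rotZ (-q.2) (q.1).2)))
      ((volume.restrict (I ×ˢ (univ : Set ℝ³))).prod ν) := by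
  -- the space–time rotations preserve the restricted measure
  have hT : ∀ φ : ℝ, MeasurePreserving (fun z : ℝ × ℝ³ => (z.1, rotZ (-φ) z.2))
      (volume.restrict (I ×ˢ (univ : Set ℝ³))) (volume.restrict (I ×ˢ (univ : Set ℝ³))) := by
    intro φ
    have h := (Seregin2020.measurePreserving_rotST (-φ)).restrict_preimage
      (hI.prod MeasurableSet.univ)
    have hpre : (fun z : ℝ × ℝ³ => (z.1, rotZ (-φ) z.2)) ⁻¹' (I ×ˢ (univ : Set ℝ³)) =
        I ×ˢ (univ : Set ℝ³) := by
      ext z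
      simp [mem_prod]
    rwa [hpre] at h
  have hc1 : Continuous fun q : (ℝ × ℝ³) × ℝ => (q.1).1 := continuous_fst.comp continuous_fst
  have hc3 : Continuous fun q : (ℝ × ℝ³) × ℝ => rotZ (-q.2) (q.1).2 :=
    continuous_rotZ_uncurry.comp₂ continuous_snd.neg (continuous_snd.comp continuous_fst)
  have hΨ : Measure.QuasiMeasurePreserving
      (fun q : (ℝ × ℝ³) × ℝ => ((q.1).1, rotZ (-q.2) (q.1).2))
      ((volume.restrict (I ×ˢ (univ : Set ℝ³))).prod ν) (volume.restrict (I ×ˢ (univ : Set ℝ³))) :=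
    QuasiMeasurePreserving.prod_of_left (hc1.prodMk hc3).measurable
      (Eventually.of_forall fun φ => (hT φ).quasiMeasurePreserving)
  have h1 : AEStronglyMeasurable (fun q : (ℝ × ℝ³) × ℝ => f ((q.1).1, rotZ (-q.2) (q.1).2))
      ((volume.restrict (I ×ˢ (univ : Set ℝ³))).prod ν) :=
    hf.comp_quasiMeasurePreserving hΨ
  have h2 : AEStronglyMeasurable
      (fun q : (ℝ × ℝ³) × ℝ => (q.2, f ((q.1).1, rotZ (-q.2) (q.1).2)))
      ((volume.restrict (I ×ˢ (univ : Set ℝ³))).prod ν) :=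
    continuous_snd.aestronglyMeasurable.prodMk h1
  -- (elaborated without the expected type: the higher-order unification against it is slow)
  have h3 := continuous_rotZ_uncurry.comp_aestronglyMeasurable h2
  exact h3

/-- **Swapping the quantifiers "for every angle" and "for a.e. point".** If for EVERY angle
`θ` the conjugated field `(t, x) ↦ R_θ f(t, R_{-θ} x)` agrees with `f` a.e. on the cylinder
`I × ℝ³`, then for a.e. `(t, x)` in the cylinder the identity `R_φ f(t, R_{-φ} x) = f(t, x)` holds
for `ν`-a.e. angle `φ`, for any s-finite `ν` (Tonelli for the defect
`((t, x), φ) ↦ ‖R_φ f(t, R_{-φ} x) − f(t, x)‖ₑ`, whose `φ`-sections integrate to zero). [folklore] -/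
theorem ae_ae_rotZ_conj_eq {I : Set ℝ} (hI : MeasurableSet I) {f : ℝ × ℝ³ → ℝ³}
    (hf : AEStronglyMeasurable f (volume.restrict (I ×ˢ (univ : Set ℝ³))))
    (hsym : ∀ θ : ℝ, (fun z : ℝ × ℝ³ => rotZ θ (f (z.1, rotZ (-θ) z.2))) =ᵐ[volume.restrict
      (I ×ˢ (univ : Set ℝ³))] f)
    (ν : Measure ℝ) [SFinite ν] :
    ∀ᵐ z ∂(volume.restrict (I ×ˢ (univ : Set ℝ³))), ∀ᵐ φ ∂ν,
      rotZ φ (f (z.1, rotZ (-φ) z.2)) = f z := by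
  have hA := aestronglyMeasurable_rotZ_conj hI hf ν
  have hB : AEStronglyMeasurable (fun q : (ℝ × ℝ³) × ℝ => f q.1)
      ((volume.restrict (I ×ˢ (univ : Set ℝ³))).prod ν) := hf.comp_fst
  have hDm : AEMeasurable
      (fun q : (ℝ × ℝ³) × ℝ => edist (rotZ q.2 (f ((q.1).1, rotZ (-q.2) (q.1).2))) (f q.1))
      ((volume.restrict (I ×ˢ (univ : Set ℝ³))).prod ν) :=
    hA.aemeasurable.edist hB.aemeasurable
  have hD0 : ∫⁻ q, edist (rotZ q.2 (f ((q.1).1, rotZ (-q.2) (q.1).2))) (f q.1)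
      ∂((volume.restrict (I ×ˢ (univ : Set ℝ³))).prod ν) = 0 := by
    rw [lintegral_prod_symm _ hDm]
    refine (lintegral_congr fun φ => ?_).trans lintegral_zero
    refine (lintegral_congr_ae ?_).trans lintegral_zero
    filter_upwards [hsym φ] with z hz
    simp only [edist_eq_zero]
    exact hz
  have hae := Measure.ae_ae_of_ae_prod ((lintegral_eq_zero_iff' hDm).1 hD0)
  filter_upwards [hae] with z hz
  filter_upwards [hz] with φ hφ
  simpa only [Pi.zero_apply, edist_eq_zero] using hφ

/-- **Haar averaging over the rotations about the axis.** Let `f` be an a.e.-strongly measurable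
field on the cylinder `I × ℝ³` (Lebesgue measure restricted to `I ×ˢ univ`) which is axisymmetric
almost everywhere in the sense that for EVERY angle `θ` the conjugated field
`(t, x) ↦ R_θ f(t, R_{-θ} x)` agrees with `f` a.e. Then `f` has a representative `g`, `g = f` a.e.
on `I × ℝ³`, every time slice of which is EXACTLY axisymmetric (`IsAxisymmetric (g t)` for all `t`):
`g(t, x) = (2π)⁻¹ ∫₀^{2π} R_φ f(t, R_{-φ} x) dφ`. Exact symmetry of `g` is the invariance of the
integral over a period under translation; `g = f` a.e. is `ae_ae_rotZ_conj_eq` (the tacit passage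
from the axisymmetric `L^p` class to an axisymmetric representative, e.g. Seregin–Šverák 2009, §3;
KNSS 2009, §1). [folklore] -/
theorem exists_axisymmetric_ae_eq {I : Set ℝ} (hI : MeasurableSet I) {f : ℝ × ℝ³ → ℝ³}
    (hf : AEStronglyMeasurable f (volume.restrict (I ×ˢ (univ : Set ℝ³))))
    (hsym : ∀ θ : ℝ, (fun z : ℝ × ℝ³ => rotZ θ (f (z.1, rotZ (-θ) z.2))) =ᵐ[volume.restrict
      (I ×ˢ (univ : Set ℝ³))] f) :
    ∃ g : ℝ → ℝ³ → ℝ³, (∀ t, IsAxisymmetric (g t)) ∧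
      uncurry g =ᵐ[volume.restrict (I ×ˢ (univ : Set ℝ³))] f := by
  have h2π : (0 : ℝ) ≤ 2 * Real.pi := by positivity
  -- the averaged field
  refine ⟨fun t x => (2 * Real.pi)⁻¹ • ∫ φ in (0 : ℝ)..2 * Real.pi, rotZ φ (f (t, rotZ (-φ) x)),
    fun t θ x => ?_, ?_⟩
  · -- exact axisymmetry of every slice
    set G : ℝ → ℝ³ := fun φ => rotZ φ (f (t, rotZ (-φ) x)) with hG
    have hper : Function.Periodic G (2 * Real.pi) := fun φ => by
      simp only [hG]
      rw [rotZ_add_two_pi_eq, show -(φ + 2 * Real.pi) = (-φ - 2 * Real.pi) by ring,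
        ← rotZ_add_two_pi_eq (-φ - 2 * Real.pi), sub_add_cancel]
    have hint : ∀ φ : ℝ, rotZ φ (f (t, rotZ (-φ) (rotZ θ x))) =
        (rotZLIE θ).toContinuousLinearEquiv (G (φ - θ)) := by
      intro φ
      simp only [hG, LinearIsometryEquiv.coe_toContinuousLinearEquiv, rotZLIE_apply]
      rw [show -(φ - θ) = -φ + θ by ring, rotZ_add (-φ) θ x, ← rotZ_add θ (φ - θ),
        show θ + (φ - θ) = φ by ring]
    show (2 * Real.pi)⁻¹ • ∫ φ in (0 : ℝ)..2 * Real.pi, rotZ φ (f (t, rotZ (-φ) (rotZ θ x))) =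
      rotZ θ ((2 * Real.pi)⁻¹ • ∫ φ in (0 : ℝ)..2 * Real.pi, G φ)
    simp_rw [hint]
    rw [intervalIntegral.integral_of_le h2π, intervalIntegral.integral_of_le h2π,
      (rotZLIE θ).toContinuousLinearEquiv.integral_comp_comm, ← intervalIntegral.integral_of_le h2π,
      ← intervalIntegral.integral_of_le h2π]
    have hshift : ∫ φ in (0 : ℝ)..2 * Real.pi, G (φ - θ) = ∫ φ in (0 : ℝ)..2 * Real.pi, G φ := by
      rw [intervalIntegral.integral_comp_sub_right G θ, zero_sub,
        show 2 * Real.pi - θ = -θ + 2 * Real.pi by ring, hper.intervalIntegral_add_eq (-θ) 0, zero_add]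
    rw [hshift, ← map_smul]
    simp only [LinearIsometryEquiv.coe_toContinuousLinearEquiv, rotZLIE_apply]
  · -- the average is a representative
    have hae := ae_ae_rotZ_conj_eq hI hf hsym (volume.restrict (Ioc (0 : ℝ) (2 * Real.pi)))
    filter_upwards [hae] with z hz
    show (2 * Real.pi)⁻¹ • ∫ φ in (0 : ℝ)..2 * Real.pi, rotZ φ (f (z.1, rotZ (-φ) z.2)) = f z
    rw [intervalIntegral.integral_of_le h2π, integral_congr_ae hz, setIntegral_const,
      Real.volume_real_Ioc_of_le h2π, sub_zero, smul_smul, inv_mul_cancel₀ (by positivity),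
      one_smul]

/-! ### Geometry of the Seregin–Šverák cylinder -/

/-- The Seregin–Šverák unit cylinder `𝒞 × ]-1, 0[` lies in the parabolic ball `Q(0, 2)`
(`|x'| < 1`, `|x₃| < 1` give `‖x‖² < 2 < 4`). [folklore] -/
theorem ssCylinder_subset_parabolicCylinder_two :
    ssCylinder ⊆ parabolicCylinder 2 ((0 : ℝ), (0 : ℝ³)) := by
  intro z hz
  rw [mem_ssCylinder] at hz
  obtain ⟨ht, hr, h3⟩ := hz
  rw [mem_parabolicCylinder]
  refine ⟨⟨by linarith [ht.1], ht.2⟩, ?_⟩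
  rw [dist_zero_right]
  have hsq : ‖z.2‖ ^ 2 = cylRadius z.2 ^ 2 + (z.2 2) ^ 2 := by
    rw [EuclideanSpace.norm_sq_eq, cylRadius_sq, Fin.sum_univ_three]
    simp only [Real.norm_eq_abs, sq_abs]
  have hr2 : cylRadius z.2 ^ 2 < 1 := by
    have h0 := cylRadius_nonneg z.2
    nlinarith
  have h32 : (z.2 2) ^ 2 < 1 := by
    have := abs_lt.1 h3
    nlinarith
  have h4 : ‖z.2‖ ^ 2 < 2 ^ 2 := by rw [hsq]; linarith
  exact lt_of_pow_lt_pow_left₀ 2 (by norm_num) h4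

/-- The Seregin–Šverák unit cylinder lies in the lower half space `ℝ³ × ℝ₋`. [folklore] -/
theorem ssCylinder_subset_lowerHalf : ssCylinder ⊆ Iio (0 : ℝ) ×ˢ (univ : Set ℝ³) :=
  fun _ hz => ⟨(mem_ssCylinder.1 hz).1.2, mem_univ _⟩

/-! ### The item -/

/-- **Route `RellichScar`, item `AxisymmetricApexFatal` (stmt-NavierStokesRegularity-11722).** An
apex profile — a suitable weak solution of Navier–Stokes on the backward slab with a weak gradient,
`𝐈(ℝ³ × ℝ₋) < ∞` and the space–time Type I bound `‖u‖ ≤ C/(‖x‖ + √(−t))` — which is singular at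
the origin cannot be almost-everywhere axisymmetric about the `x₃`-axis. Haar averaging
(`exists_axisymmetric_ae_eq`) gives an exactly axisymmetric representative `v = u` a.e.; the
pressure normalised by its unit-ball means is `L^{3/2}` up to the final time on `Q(0, 2)`
(`isSuitableWeakSolutionInBall_of_slab`); on the unit cylinder `𝒞 × ]-1,0[ ⊆ Q(0, 2)` the pair
is then a distributional solution with `v ∈ L³`, `q ∈ L^{3/2}`, axisymmetric slices and
`√(−t)‖v‖ ≤ |C|` a.e., so Seregin–Šverák 2009, Thm 3.1
(`Literature.Barriers.NavierStokesRegularity.AxisymmetricTypeIExclusion_holds`, proved in the tree)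
makes the origin regular, contradicting `IsBackwardSingularPoint u 0`.
[cite: SereginSverak2009, Thm 3.1 (= Thm 1.1)] -/
theorem rellichScar_axisymmetricApexFatal_proof :
    Summit.NavierStokesRegularity.NavierStokesRegularity.Theses.RellichScar.AxisymmetricApexFatal := by
  unfold Summit.NavierStokesRegularity.NavierStokesRegularity.Theses.RellichScar.AxisymmetricApexFatal
  intro u p G C hsw hG hI hdec hsing hsym
  -- Step 0: normalise the pressure by its unit-ball means
  set q : ℝ → ℝ³ → ℝ := fun t x => p t x - ⨍ y in ball (0 : ℝ³) 1, p t y with hq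
  have hpli : LocallyIntegrableOn (uncurry p) (Iio (0 : ℝ) ×ˢ (univ : Set ℝ³)) volume :=
    hsw.distributional.2.2.1
  have hswq : IsSuitableWeakSolutionOn (slab ℝ³ (Iio (0 : ℝ)) isOpen_Iio) 1 0 u q :=
    hsw.sub_unitBallMean_slab
  have hIq : typeIBound (Iio (0 : ℝ) ×ˢ (univ : Set ℝ³)) u q G < ∞ := by
    rw [typeIBound_sub_unitBallMean hpli]
    exact hI
  have hq0 : ∀ t, ⨍ y in ball (0 : ℝ³) 1, q t y = 0 := unitBallMean_sub_unitBallMean p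
  have hball : IsSuitableWeakSolutionInBall 2 0 u q :=
    isSuitableWeakSolutionInBall_of_slab hswq hG hIq.ne hq0 (by norm_num)
  -- Step 1: the exactly axisymmetric representative
  have hum : AEStronglyMeasurable (uncurry u) (volume.restrict (Iio (0 : ℝ) ×ˢ (univ : Set ℝ³))) :=
    hsw.distributional.1.aestronglyMeasurable
  obtain ⟨v, hvax, hv⟩ := exists_axisymmetric_ae_eq measurableSet_Iio hum hsym
  -- Step 2: the hypotheses of Seregin–Šverák 2009, Thm 3.1 on the unit cylinder
  have hcyl2 := ssCylinder_subset_parabolicCylinder_two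
  have hcylS := ssCylinder_subset_lowerHalf
  have hvS : ∀ᵐ z ∂(volume.restrict ssCylinder), uncurry v z = uncurry u z :=
    ae_restrict_of_ae_restrict_of_subset hcylS hv
  have h1 : IsDistributionalNSSolutionOn ssCylinderOpens 1 0 v q := by
    have hle : ssCylinderOpens ≤ parabolicCylinderOpens 2 ((0 : ℝ), (0 : ℝ³)) :=
      fun _ hz => hcyl2 hz
    have hd : IsDistributionalNSSolutionOn ssCylinderOpens 1 0 u q :=
      hball.1.distributional.of_le hle
    refine hd.congr_ae ?_ (ae_of_all _ fun _ => rfl)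
    filter_upwards [hvS] with z hz
    exact hz.symm
  have h2 : ∫⁻ z in ssCylinder, ‖v z.1 z.2‖ₑ ^ (3 : ℕ) < ∞ := by
    have hC : cknC 2 0 u ≤ typeIBound (Iio (0 : ℝ) ×ˢ (univ : Set ℝ³)) u q G :=
      (cknC_le_abScaledSum (p := q) (G := G)).trans
        (abScaledSum_le_typeIBound two_pos (parabolicCylinder_subset_lowerHalf le_rfl 2))
    unfold cknC at hC
    have h22 : ENNReal.ofReal 2 ^ 2 ≠ 0 := pow_ne_zero _ (ENNReal.ofReal_pos.2 two_pos).ne'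
    have h22' : ENNReal.ofReal 2 ^ 2 ≠ ∞ := ENNReal.pow_ne_top ENNReal.ofReal_ne_top
    have hfin : ∫⁻ w in parabolicCylinder 2 (0 : ℝ × ℝ³), ‖u w.1 w.2‖ₑ ^ (3 : ℕ) < ∞ :=
      lt_of_le_of_lt ((ENNReal.inv_mul_le_iff h22 h22').1 hC)
        (ENNReal.mul_lt_top (ENNReal.pow_lt_top ENNReal.ofReal_lt_top) hIq)
    calc ∫⁻ z in ssCylinder, ‖v z.1 z.2‖ₑ ^ (3 : ℕ)
        = ∫⁻ z in ssCylinder, ‖u z.1 z.2‖ₑ ^ (3 : ℕ) := by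
          refine lintegral_congr_ae ?_
          filter_upwards [hvS] with z hz
          simp only [uncurry] at hz
          rw [hz]
      _ ≤ ∫⁻ z in parabolicCylinder 2 ((0 : ℝ), (0 : ℝ³)), ‖u z.1 z.2‖ₑ ^ (3 : ℕ) :=
          lintegral_mono_set hcyl2
      _ < ∞ := hfin
  have h3 : ∫⁻ z in ssCylinder, ‖q z.1 z.2‖ₑ ^ (3 / 2 : ℝ) < ∞ := by
    obtain ⟨h32, h32', h32r⟩ := threeHalves_facts
    have hmem : MemLp (uncurry q) (3 / 2)
        (volume.restrict (parabolicCylinder 2 (0 : ℝ × ℝ³))) := hball.2.2.2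
    have hfin := lintegral_rpow_enorm_lt_top_of_eLpNorm_lt_top (zero_lt_one.trans_le h32).ne' h32'
      hmem.eLpNorm_lt_top
    rw [h32r] at hfin
    exact lt_of_le_of_lt (lintegral_mono_set hcyl2) hfin
  have h4 : ∀ t ∈ Ioo (-1 : ℝ) 0, IsAxisymmetric (v t) := fun t _ => hvax t
  have h5 : ∃ C' : ℝ, ∀ᵐ z ∂(volume.restrict ssCylinder), Real.sqrt (-z.1) * ‖v z.1 z.2‖ ≤ C' := by
    refine ⟨|C|, ?_⟩
    filter_upwards [ae_restrict_mem isOpen_ssCylinder.measurableSet, hvS] with z hz hvz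
    simp only [uncurry] at hvz
    rw [hvz]
    have ht : z.1 < 0 := (mem_ssCylinder.1 hz).1.2
    have hs : 0 < Real.sqrt (-z.1) := Real.sqrt_pos.2 (by linarith)
    have hd : 0 < ‖z.2‖ + Real.sqrt (-z.1) := add_pos_of_nonneg_of_pos (norm_nonneg _) hs
    have hsd : Real.sqrt (-z.1) / (‖z.2‖ + Real.sqrt (-z.1)) ≤ 1 :=
      (div_le_one hd).2 (le_add_of_nonneg_left (norm_nonneg _))
    calc Real.sqrt (-z.1) * ‖u z.1 z.2‖
        ≤ Real.sqrt (-z.1) * (C / (‖z.2‖ + Real.sqrt (-z.1))) :=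
          mul_le_mul_of_nonneg_left (hdec z.1 ht z.2) hs.le
      _ ≤ Real.sqrt (-z.1) * (|C| / (‖z.2‖ + Real.sqrt (-z.1))) := by
          gcongr
          exact le_abs_self C
      _ = |C| * (Real.sqrt (-z.1) / (‖z.2‖ + Real.sqrt (-z.1))) := by ring
      _ ≤ |C| * 1 := by gcongr
      _ = |C| := mul_one _
  -- Step 3: Seregin–Šverák 2009, Thm 3.1: the origin is regular for `v`, hence for `u`
  obtain ⟨r, hr, hbd⟩ := AxisymmetricTypeIExclusion_holds v q h1 h2 h3 h4 h5
  have hsub : parabolicCylinder r ((0 : ℝ), (0 : ℝ³)) ⊆ Iio (0 : ℝ) ×ˢ (univ : Set ℝ³) :=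
    parabolicCylinder_subset_lowerHalf le_rfl r
  have heq : eLpNorm (uncurry u) ∞ (volume.restrict (parabolicCylinder r ((0 : ℝ), (0 : ℝ³)))) =
      eLpNorm (uncurry v) ∞ (volume.restrict (parabolicCylinder r ((0 : ℝ), (0 : ℝ³)))) :=
    eLpNorm_congr_ae (ae_restrict_of_ae_restrict_of_subset hsub hv.symm)
  have hinf : eLpNorm (uncurry u) ∞ (volume.restrict (parabolicCylinder r ((0 : ℝ), (0 : ℝ³)))) = ∞ :=
    hsing r hr
  rw [hinf] at heq
  exact hbd.ne heq.symm

end Summit.NavierStokesRegularity.NavierStokesRegularity.Theorems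

end
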